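import Literature.Analysis.FunctionSpaces.HellySelection
import Literature.Analysis.FunctionSpaces.DiagonalWeakLimits
import HarnessLib

/-!
# Helly's selection lemma for uniformly bounded monotone functions — proof

Discharges the named fact `Literature.Analysis.FunctionSpaces.helly_selection_monotoneOn`
(Carothers, *Real Analysis*, CUP 2000, Ch. 13, **Lemma 13.15**, book p. 211) by formalizing the
printed proof:

1. *Helly's Selection Principle 13.13* (diagonalization over a countable set): a subsequence
   converging at every rational point — the tree lemma
   `Literature.Analysis.FunctionSpaces.exists_strictMono_forall_tendsto_real`;
2. the monotone limit of the values at rational points squeezes `f_{n_k}(x)` at every continuity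
   point `x` of the (monotone, hence with countably many jumps) limit function — packaged in the
   tree as `Literature.Analysis.FunctionSpaces.exists_countable_forall_tendsto_of_antitoneOn`
   (convergence off a countable jump set `J`, for non-increasing functions on `[0, ∞)`);
3. "the clincher": Selection Principle 13.13 once more on the countable set `J`, and the pointwise
   limit of increasing functions is increasing (and keeps the bound `K`).

Design: the extraction is first proved for antitone functions on `ℝ` restricted to `t ≥ 0`
(`helly_selection_antitone_aux`, the shape of the tree lemma in step 2); an increasing `f n` on
`[a, b]` is brought to that shape by the reflection-and-clamp `t ↦ f n (max a (min (b - t) b))`,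
which is non-increasing on `ℝ`, bounded by `K`, and equals `f n x` at `t = b - x` for `x ∈ [a, b]`.
Carothers' Lemma 13.14 (sup-extension of the limit from the rationals) is subsumed by the inf/sup
envelopes inside the step-2 lemma. Nothing else of Ch. 13 (Helly's First Theorem 13.16 for `BV`)
is attempted here.

## References

* N. L. Carothers, *Real Analysis*, Cambridge University Press 2000, Selection Principle 13.13,
  Lemma 13.15 (pp. 210–211). doi:10.1017/cbo9780511814228
* E. Helly, *Über lineare Funktionaloperationen*, S.-B. K. Akad. Wiss. Wien 121 (1912) 265–297.
-/

namespace Literature.Analysis.FunctionSpaces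

open Filter Set
open scoped _root_.Topology

/-- **Helly extraction for non-increasing functions, on `[0, ∞)`** (Carothers 2000, proof of
Lemma 13.15, run for antitone functions): if every `g n : ℝ → ℝ` is non-increasing and
`|g n t| ≤ K` for all `n, t`, then along some subsequence `g (φ k) t` converges for every `t ≥ 0`.
Proof as printed: diagonal extraction on the rationals (Selection Principle 13.13), convergence
off the countable jump set `J` of the monotone limit, and a second diagonal extraction on
`J ∪ {0}`. [cite: Carothers2000, Lemma 13.15 (proof)] -/
theorem helly_selection_antitone_aux {g : ℕ → ℝ → ℝ} {K : ℝ} (hg : ∀ n, Antitone (g n))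
    (hK : ∀ n t, |g n t| ≤ K) :
    ∃ φ : ℕ → ℕ, StrictMono φ ∧
      ∀ t, 0 ≤ t → ∃ l, Tendsto (fun k => g (φ k) t) atTop (𝓝 l) := by
  -- Step 1 (Selection Principle 13.13 on the rationals): a subsequence converging at every `q : ℚ`
  obtain ⟨φ₁, hφ₁, hconv₁⟩ :=
    exists_strictMono_forall_tendsto_real (fun n (q : ℚ) => g n q) fun q => ⟨K, fun n => hK n q⟩
  -- Step 2: convergence at every `t > 0` off the countable jump set `J` of the monotone limit
  have hD : ∀ a b : ℝ, 0 ≤ a → a < b → ∃ q ∈ Set.range ((↑) : ℚ → ℝ), a < q ∧ q < b := by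
    intro a b _ hab
    obtain ⟨q, haq, hqb⟩ := exists_rat_btwn hab
    exact ⟨q, ⟨q, rfl⟩, haq, hqb⟩
  have hL : ∀ x ∈ Set.range ((↑) : ℚ → ℝ), 0 ≤ x →
      Tendsto (fun n => g (φ₁ n) x) atTop (𝓝 (limUnder atTop fun n => g (φ₁ n) x)) := by
    rintro _ ⟨q, rfl⟩ _
    exact tendsto_nhds_limUnder (hconv₁ q)
  obtain ⟨J, hJ, hconvJ⟩ := exists_countable_forall_tendsto_of_antitoneOn
    (g := fun n => g (φ₁ n)) hD (fun n => (hg (φ₁ n)).antitoneOn _) hL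
  -- Step 3 ("the clincher"): a second diagonal extraction on the countable set `J ∪ {0}`
  haveI : Countable (insert (0 : ℝ) J : Set ℝ) := (hJ.insert 0).to_subtype
  obtain ⟨φ₂, hφ₂, hconv₂⟩ :=
    exists_strictMono_forall_tendsto_real (fun n (t : (insert (0 : ℝ) J : Set ℝ)) => g (φ₁ n) t)
      fun t => ⟨K, fun n => hK _ _⟩
  refine ⟨φ₁ ∘ φ₂, hφ₁.comp hφ₂, fun t ht => ?_⟩
  by_cases htE : t ∈ insert (0 : ℝ) J
  · exact hconv₂ ⟨t, htE⟩
  · have ht0 : 0 < t := lt_of_le_of_ne ht fun h => htE (Set.mem_insert_iff.2 (Or.inl h.symm))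
    have htJ : t ∉ J := fun h => htE (Set.mem_insert_of_mem _ h)
    obtain ⟨l, hl⟩ := hconvJ t ht0 htJ
    exact ⟨l, hl.comp hφ₂.tendsto_atTop⟩

/-- **Helly's selection lemma for increasing functions holds** (Carothers 2000, *Real Analysis*,
Lemma 13.15, p. 211; Helly 1912): discharge of the named fact
`Literature.Analysis.FunctionSpaces.helly_selection_monotoneOn`. For `b < a` the interval is empty
and everything is vacuous; for `a ≤ b` apply `helly_selection_antitone_aux` to the non-increasing,
`K`-bounded functions `t ↦ f n (max a (min (b - t) b))` (which equal `f n x` at `t = b - x ≥ 0`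
for `x ∈ [a, b]`), take `g x := lim_k f (φ k) x`, and pass monotonicity and the bound `|·| ≤ K`
to the limit. [cite: Carothers2000, Lemma 13.15] -/
theorem helly_selection_monotoneOn_holds : helly_selection_monotoneOn := by
  intro a b K f hf hK
  rcases lt_or_ge b a with hab | hab
  · -- empty interval: vacuous
    refine ⟨id, strictMono_id, fun _ => 0, fun _ _ _ _ _ => le_rfl, fun x hx => ?_, fun x hx => ?_⟩ <;>
      exact absurd hx.1 (not_le.2 (hx.2.trans_lt hab))
  · -- reflect and clamp: `t ↦ f n (max a (min (b - t) b))` is antitone on `ℝ` and bounded by `K`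
    have hc_mem : ∀ y, max a (min y b) ∈ Icc a b := fun y =>
      ⟨le_max_left _ _, max_le hab (min_le_right _ _)⟩
    have hc_mono : ∀ y z, y ≤ z → max a (min y b) ≤ max a (min z b) := fun y z h =>
      max_le_max le_rfl (min_le_min h le_rfl)
    obtain ⟨φ, hφ, hconv⟩ := helly_selection_antitone_aux
      (g := fun n t => f n (max a (min (b - t) b))) (K := K)
      (fun n s t hst => hf n (hc_mem _) (hc_mem _) (hc_mono _ _ (sub_le_sub_left hst b)))
      (fun n t => hK n _ (hc_mem _))
    -- convergence at every point of `[a, b]`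
    have hconv' : ∀ x ∈ Icc a b, ∃ l, Tendsto (fun k => f (φ k) x) atTop (𝓝 l) := by
      intro x hx
      obtain ⟨l, hl⟩ := hconv (b - x) (sub_nonneg.2 hx.2)
      refine ⟨l, ?_⟩
      simpa only [sub_sub_cancel, min_eq_left hx.2, max_eq_right hx.1] using hl
    refine ⟨φ, hφ, fun x => limUnder atTop fun k => f (φ k) x, ?_, ?_, ?_⟩
    · -- the pointwise limit of increasing functions is increasing
      intro x hx y hy hxy
      exact le_of_tendsto_of_tendsto (tendsto_nhds_limUnder (hconv' x hx))
        (tendsto_nhds_limUnder (hconv' y hy)) (Eventually.of_forall fun k => hf _ hx hy hxy)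
    · -- the bound `|g x| ≤ K` passes to the limit
      intro x hx
      exact abs_le.2 (isClosed_Icc.mem_of_tendsto (tendsto_nhds_limUnder (hconv' x hx))
        (Eventually.of_forall fun k => abs_le.1 (hK _ x hx)))
    · exact fun x hx => tendsto_nhds_limUnder (hconv' x hx)

end Literature.Analysis.FunctionSpaces
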